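import Mathlib.Analysis.SpecialFunctions.Integrals.Basic
import Mathlib.Analysis.SpecialFunctions.Log.NegMulLog
import Mathlib.Algebra.Ring.GeomSum
import HarnessLib

/-!
# Two elementary integrals of Rhin–Viola: `∫₀¹ (z−x)^{t−1} dx` and `∫₀¹ (z−x)^{t−1} log x dx`

Topic `Literature/NumberTheory/DiophantineApproximation`. Everything here is PROVED (no definitions, no named
facts). Source: G. Rhin, C. Viola, *The permutation group method for the dilogarithm*, Ann. Sc. Norm. Super.
Pisa Cl. Sci. (5) 4 (2005) 389–437, proof of Lemma 2.7 (pp. 402–404): for integers `t ≥ 1` and real `z`,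

* `∫₀¹ (z−x)^{t−1} dx = (z^t − (z−1)^t)/t`;
* (p. 404, "as in (2.19), … by partial integration")
  `−∫₀¹ (z−x)^{t−1} log x dx = (1/t) ∫₀¹ (z^t − (z−x)^t)/(z − (z−x)) dx = (1/t) Σ_{u=1}^{t} z^{t−u} (z^u − (z−1)^u)/u`.

These feed the explicit polynomials `P, Q, R` of Lemma 2.7 (the tuple `(h, j, 0, 0, j)` of Theorem 2.1).
We write `t = n + 1`. The second formula is proved by the fundamental theorem of calculus with the explicit
primitive `F(x) = Pₙ(x)·(x log x) − Ψₙ(x)`, `Pₙ(x) = (1/(n+1)) Σ_{u≤n} z^{n−u}(z−x)^u` (so that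
`x·Pₙ(x) = (z^{n+1} − (z−x)^{n+1})/(n+1)`, a geometric sum) and `Ψₙ' = Pₙ`, which is continuous on `[0,1]`
(`x log x → 0`), so that no improper partial integration is needed.

## References

* G. Rhin, C. Viola, Ann. Sc. Norm. Super. Pisa Cl. Sci. (5) 4 (2005) 389–437, (2.19) and p. 404.
  [RhinViola2005]
-/

noncomputable section

namespace Literature.NumberTheory.DiophantineApproximation

namespace RhinViola

open _root_.MeasureTheory _root_.Set intervalIntegral Finset

/-- `∫₀¹ (z−x)^n dx = (z^{n+1} − (z−1)^{n+1})/(n+1)`. [cite: RhinViola2005, Lemma 2.7 (proof), p. 403] -/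
theorem integral_sub_pow (z : ℝ) (n : ℕ) :
    ∫ x in (0 : ℝ)..1, (z - x) ^ n = (z ^ (n + 1) - (z - 1) ^ (n + 1)) / (n + 1) := by
  rw [intervalIntegral.integral_comp_sub_left (fun x : ℝ => x ^ n) z, integral_pow, sub_zero]

/-- The geometric-sum identity `x · Σ_{u≤n} z^{n−u}(z−x)^u = z^{n+1} − (z−x)^{n+1}`. [folklore] -/
theorem mul_sum_pow_mul_sub_pow (z x : ℝ) (n : ℕ) :
    x * ∑ u ∈ range (n + 1), z ^ (n - u) * (z - x) ^ u = z ^ (n + 1) - (z - x) ^ (n + 1) := by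
  have h := geom_sum₂_mul (z - x) z (n + 1)
  -- `(Σ (z−x)^i z^{n−i}) · ((z−x) − z) = (z−x)^{n+1} − z^{n+1}`
  have hs : ∑ i ∈ range (n + 1), (z - x) ^ i * z ^ (n + 1 - 1 - i) =
      ∑ u ∈ range (n + 1), z ^ (n - u) * (z - x) ^ u :=
    sum_congr rfl fun i _ => by rw [show n + 1 - 1 - i = n - i by omega, mul_comm]
  rw [hs] at h
  linear_combination -h

/-- **`−∫₀¹ (z−x)^n log x dx = (1/(n+1)) Σ_{u≤n} z^{n−u} (z^{u+1} − (z−1)^{u+1})/(u+1)`** (Rhin–Viola,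
p. 404, by partial integration; here via the continuous primitive `Pₙ(x)(x log x) − Ψₙ(x)`).
[cite: RhinViola2005, Lemma 2.7 (proof), p. 404] -/
theorem neg_integral_sub_pow_mul_log (z : ℝ) (n : ℕ) :
    -∫ x in (0 : ℝ)..1, (z - x) ^ n * Real.log x =
      1 / (n + 1) * ∑ u ∈ range (n + 1), z ^ (n - u) * ((z ^ (u + 1) - (z - 1) ^ (u + 1)) / (u + 1)) := by
  -- the polynomials `P` (with `x P(x) = (z^{n+1} − (z−x)^{n+1})/(n+1)`) and `Ψ` (with `Ψ' = P`)
  set P : ℝ → ℝ := fun x => 1 / (n + 1) * ∑ u ∈ range (n + 1), z ^ (n - u) * (z - x) ^ u with hP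
  set Ψ : ℝ → ℝ := fun x =>
    -(1 / (n + 1)) * ∑ u ∈ range (n + 1), z ^ (n - u) * ((z - x) ^ (u + 1) / (u + 1)) with hΨ
  set F : ℝ → ℝ := fun x => P x * (x * Real.log x) - Ψ x with hF
  have hn : ((n : ℝ) + 1) ≠ 0 := by positivity
  have hxP : ∀ x, x * P x = (z ^ (n + 1) - (z - x) ^ (n + 1)) / (n + 1) := fun x => by
    rw [hP]
    simp only
    rw [← mul_assoc, mul_comm x, mul_assoc, mul_sum_pow_mul_sub_pow]
    ring
  -- continuity
  have hPc : Continuous P := by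
    simp only [hP]
    fun_prop
  have hΨc : Continuous Ψ := by
    simp only [hΨ]
    fun_prop
  have hFc : Continuous F := (hPc.mul Real.continuous_mul_log).sub hΨc
  -- derivatives on `(0, 1)`
  have hΨd : ∀ x, HasDerivAt Ψ (P x) x := by
    intro x
    simp only [hΨ, hP]
    have hterm : ∀ u ∈ range (n + 1), HasDerivAt (fun x : ℝ => z ^ (n - u) * ((z - x) ^ (u + 1) / (u + 1)))
        (-(z ^ (n - u) * (z - x) ^ u)) x := by
      intro u _
      have hu : ((u : ℝ) + 1) ≠ 0 := by positivity
      have h1 : HasDerivAt (fun x : ℝ => (z - x) ^ (u + 1)) (((u : ℝ) + 1) * (z - x) ^ u * -1) x := by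
        refine ((hasDerivAt_pow (u + 1) (z - x)).comp x ((hasDerivAt_id x).const_sub z)).congr_deriv ?_
        rw [Nat.add_sub_cancel]
        push_cast
        ring
      refine ((h1.div_const ((u : ℝ) + 1)).const_mul (z ^ (n - u))).congr_deriv ?_
      field_simp
    have hs := (HasDerivAt.fun_sum hterm).const_mul (-(1 / ((n : ℝ) + 1)))
    refine hs.congr_deriv ?_
    rw [sum_neg_distrib]
    ring
  have hPd : ∀ x, HasDerivAt (fun x => x * P x) ((z - x) ^ n) x := by
    intro x
    have h1 : HasDerivAt (fun x : ℝ => (z ^ (n + 1) - (z - x) ^ (n + 1)) / (n + 1))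
        ((0 - ((n : ℝ) + 1) * (z - x) ^ n * -1) / (n + 1)) x := by
      refine HasDerivAt.div_const (HasDerivAt.sub (hasDerivAt_const x _) ?_) _
      refine ((hasDerivAt_pow (n + 1) (z - x)).comp x ((hasDerivAt_id x).const_sub z)).congr_deriv ?_
      rw [Nat.add_sub_cancel]
      push_cast
      ring
    have h2 : (fun x => x * P x) = fun x : ℝ => (z ^ (n + 1) - (z - x) ^ (n + 1)) / (n + 1) :=
      funext hxP
    rw [h2]
    refine h1.congr_deriv ?_
    field_simp
    ring
  have hFd : ∀ x ∈ Ioo (0 : ℝ) 1, HasDerivAt F ((z - x) ^ n * Real.log x) x := by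
    intro x hx
    have hx0 : x ≠ 0 := hx.1.ne'
    -- near `x > 0`, `F y = (y P y) log y − Ψ y`
    have hFeq : F =ᶠ[nhds x] fun y => (y * P y) * Real.log y - Ψ y := by
      filter_upwards [] with y
      simp only [hF]
      ring
    have hd : HasDerivAt (fun y => (y * P y) * Real.log y - Ψ y)
        ((z - x) ^ n * Real.log x + x * P x * x⁻¹ - P x) x :=
      ((hPd x).mul (Real.hasDerivAt_log hx0)).sub (hΨd x)
    refine (hd.congr_of_eventuallyEq hFeq).congr_deriv ?_
    field_simp
    ring
  -- integrability of `(z−x)^n log x` on `[0,1]`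
  have hint : IntervalIntegrable (fun x => (z - x) ^ n * Real.log x) volume 0 1 :=
    (intervalIntegrable_log'.continuousOn_mul (by fun_prop : Continuous fun x : ℝ => (z - x) ^ n).continuousOn)
  have hftc := integral_eq_sub_of_hasDerivAt_of_le zero_le_one hFc.continuousOn hFd hint
  rw [hftc]
  simp only [hF, hΨ, Real.log_one, Real.log_zero, mul_zero, sub_zero, zero_sub]
  rw [mul_sum, mul_sum, mul_sum, show ∀ A B : ℝ, -(-A - -B) = A - B from fun A B => by ring, ← sum_sub_distrib]
  refine sum_congr rfl fun u _ => ?_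
  ring
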